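import Literature.AnabelianGeometry.EtaleTheta.ThetaCoversModelNumerology
import Literature.AnabelianGeometry.EtaleTheta.SettingBridge
import HarnessLib

/-!
# [EtTh] §2 at the §1 MODEL, phase 2a: the profinite `Π_C ⊇ Π_X` input package of `C = X/{±1}`; transport
# of `Ker(Δ_X ↠ Δ̄_X)`, the `Δ̄_Θ`-preimage and `D_x` into `Π_C` (model definitions for `CoverData`)

Mochizuki, *The étale theta function …* [EtTh], Publ. RIMS **45** (2009), §2, PRIMS PDF pp. 35–36:
"`1 → Δ_X → Π_X → G_K → 1`" (p. 35); "the stack-theoretic quotient of `X^log` … by the action of `ι` … by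
`C^log` … We shall write `Π_C` … for the … (profinite) étale fundamental group of `C^log` … subgroups
`Δ_C ⊆ Π_C` … [i.e., the kernels of the natural surjections to `G_K`]", "`Gal(X/C) ≅ ℤ/2ℤ`" (p. 36);
"`D_x ⊆ Π_X` is the decomposition group associated to `x` — which maps the inertia group `I_x ⊆ D_x`
isomorphically onto `Δ̄_Θ`" (p. 35) [cite: MochizukiEtTh2009, Def 2.1 p.36].

Layer L2 of the abc-iut cell, merge row W3-L2-02 / P2-a (seat abc-iut-L2-t10, gen 4; L2-lead GO
2026-08-26T02:37:36Z; abc-iut-L2-d3's census `W3-L2-02-CENSUS.md` §3). The §1 structures carry the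
tempered `Π^tp_X` with its profinite completion `Π_X = D.PiHat` and (in `MuTwoSetting`) a tempered
`Π^tp_C` WITHOUT completion or augmentation — not the profinite `Π_C` of §2. This file records that
missing input as a PARAMETER BUNDLE `ThetaSetting.PiCData D` (census P-C1/P-C2; GAP-LEDGER G-L2t10-2;
ruling η′ "parameters, never named facts": the profinite `Π_C`, the closed embedding `Π_X ↪ Π_C` with
normal image of index `2`, the augmentation `Π_C → G_K` extending `Π_X → G_K`) and TRANSPORTS phase
1a (`ThetaCoversModelDefs/Heisenberg/Numerology`) into `Π_C`: the generic recipe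
`ClassTwoBar.barKerOf/barThetaOf Δ l` (normal for `Δ ⊴ G`, closed, functorial along closed embeddings;
`barKerHat = barKerOf Δ_X` by `rfl`), `PiCData.DeltaX = Π_X ∩ Δ_C` (given (P1) of abc-iut-L2-t7's
`OncePuncturedData`), `PiCData.barKer/barTheta` — NORMAL IN `Π_C`, closed, `relIndex = l`, rank-two
quotient, central, `l`-th powers — and `PiCData.Dx` (closure of the cusp's decomposition group) mapping
ONTO `G_K` ((P4) of `OncePuncturedData`). The constructor `CoverDataAx.ofSetting` (printed inputs P-C3
"`I_x ⥲ Δ̄_Θ`", P-C4 "`ι` acts by `−1`" as named binders) is `ThetaCoversAxOfSetting.lean`. DEFINITIONS +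
kernel-checked lemmas; no instance beyond the structure-carried ones, no new Prop fact; [EtTh] is
refereed; nothing here takes a side on [IUTchIII] Cor. 3.12.
-/

noncomputable section

namespace Literature.AnabelianGeometry.EtaleTheta

open scoped commutatorElement
open _root_.Topology Literature.AnabelianGeometry.SemiGraphs

/-! ### Generic recipe: `Ker(Δ ↠ Δ̄)` and the `Δ̄_Θ`-preimage for a normal subgroup `Δ` -/

namespace ClassTwoBar

variable {G : Type*} [Group G] (Δ : Subgroup G) (l : ℕ)

/-- The `l`-th powers of `Δ` (a subset of `G`). [cite: MochizukiEtTh2009, Def 2.1 p.35] -/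
def powSet : Set G := {x : G | ∃ y ∈ Δ, x = y ^ l}

/-- For `Δ ⊴ G` the `l`-th power set is conjugation-invariant, so its normal closure is the subgroup it
generates. [cite: MochizukiEtTh2009, Def 2.1 p.35] -/
theorem normalClosure_powSet_eq (hΔ : Δ.Normal) :
    Subgroup.normalClosure (powSet Δ l) = Subgroup.closure (powSet Δ l) := by
  refine le_antisymm ?_ Subgroup.closure_le_normalClosure
  change Subgroup.closure (Group.conjugatesOfSet _) ≤ _
  refine Subgroup.closure_mono fun x hx => ?_
  obtain ⟨a, ⟨y, hy, rfl⟩, hax⟩ := Group.mem_conjugatesOfSet_iff.1 hx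
  obtain ⟨c, rfl⟩ := isConj_iff.1 hax
  exact ⟨c * y * c⁻¹, hΔ.conj_mem y hy c, by rw [conj_pow]⟩

/-- The `l`-th power set is functorial. [cite: MochizukiEtTh2009, Def 2.1 p.35] -/
theorem image_powSet {G' : Type*} [Group G'] (f : G →* G') : f '' powSet Δ l = powSet (Δ.map f) l := by
  ext x
  simp only [powSet, Set.mem_image, Set.mem_setOf_eq, Subgroup.mem_map]
  constructor
  · rintro ⟨_, ⟨y, hy, rfl⟩, rfl⟩
    exact ⟨f y, ⟨y, hy, rfl⟩, by rw [map_pow]⟩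
  · rintro ⟨_, ⟨y, hy, rfl⟩, rfl⟩
    exact ⟨y ^ l, ⟨y, hy, rfl⟩, by rw [map_pow]⟩

variable [TopologicalSpace G] [IsTopologicalGroup G]

/-- `Ker(Δ ↠ Δ̄)` for a subgroup `Δ` of a topological group: the closure of
`[[Δ,Δ],Δ] · ⟨l-th powers of Δ⟩^normal` (the recipe of `ThetaSetting.barKerHat`, p. 35).
[cite: MochizukiEtTh2009, Def 2.1 p.35] -/
def barKerOf : Subgroup G := (⁅⁅Δ, Δ⁆, Δ⁆ ⊔ Subgroup.normalClosure (powSet Δ l)).topologicalClosure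

/-- The `Δ̄_Θ`-preimage for `Δ`: the closure of `[Δ,Δ] · ⟨l-th powers of Δ⟩^normal` (the recipe of
`ThetaSetting.barThetaHat`, p. 35). [cite: MochizukiEtTh2009, Def 2.1 p.35] -/
def barThetaOf : Subgroup G := (⁅Δ, Δ⁆ ⊔ Subgroup.normalClosure (powSet Δ l)).topologicalClosure

/-- `barKerOf Δ l ⊴ G` for `Δ ⊴ G`. [cite: MochizukiEtTh2009, Def 2.1 p.35] -/
theorem barKerOf_normal (hΔ : Δ.Normal) : (barKerOf Δ l).Normal := by
  haveI := hΔ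
  haveI : (Subgroup.normalClosure (powSet Δ l)).Normal := Subgroup.normalClosure_normal
  haveI : (⁅⁅Δ, Δ⁆, Δ⁆ ⊔ Subgroup.normalClosure (powSet Δ l)).Normal := Subgroup.sup_normal _ _
  exact Subgroup.is_normal_topologicalClosure _

/-- `barThetaOf Δ l ⊴ G` for `Δ ⊴ G`. [cite: MochizukiEtTh2009, Def 2.1 p.35] -/
theorem barThetaOf_normal (hΔ : Δ.Normal) : (barThetaOf Δ l).Normal := by
  haveI := hΔ
  haveI : (Subgroup.normalClosure (powSet Δ l)).Normal := Subgroup.normalClosure_normal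
  haveI : (⁅Δ, Δ⁆ ⊔ Subgroup.normalClosure (powSet Δ l)).Normal := Subgroup.sup_normal _ _
  exact Subgroup.is_normal_topologicalClosure _

/-- `barKerOf` is closed. [cite: MochizukiEtTh2009, Def 2.1 p.35] -/
theorem isClosed_barKerOf : IsClosed (barKerOf Δ l : Set G) := Subgroup.isClosed_topologicalClosure _
/-- `barThetaOf` is closed. [cite: MochizukiEtTh2009, Def 2.1 p.35] -/
theorem isClosed_barThetaOf : IsClosed (barThetaOf Δ l : Set G) := Subgroup.isClosed_topologicalClosure _

variable {G' : Type*} [Group G'] [TopologicalSpace G'] [IsTopologicalGroup G']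

/-- Along a CLOSED EMBEDDING of topological groups, the closure of a subgroup is carried to the closure of
its image. [cite: MochizukiEtTh2009, Def 2.1 p.35] -/
theorem map_topologicalClosure_of_isClosedEmbedding (f : G →ₜ* G') (hf : IsClosedEmbedding f)
    (H : Subgroup G) : (H.topologicalClosure).map f.toMonoidHom = (H.map f.toMonoidHom).topologicalClosure := by
  apply SetLike.coe_injective
  rw [Subgroup.coe_map, Subgroup.topologicalClosure_coe, Subgroup.topologicalClosure_coe, Subgroup.coe_map]
  exact (hf.closure_image_eq _).symm

/-- **Transport of `Ker(Δ ↠ Δ̄)`** along a closed embedding `f` with `Δ`, `f(Δ)` normal: `f` carries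
`barKerOf Δ l` onto `barKerOf (f Δ) l` (commutators, powers and closures are functorial; normal closure
= closure on both sides). [cite: MochizukiEtTh2009, Def 2.1 p.35] -/
theorem map_barKerOf (f : G →ₜ* G') (hf : IsClosedEmbedding f) (hΔ : Δ.Normal)
    (hΔ' : (Δ.map f.toMonoidHom).Normal) :
    (barKerOf Δ l).map f.toMonoidHom = barKerOf (Δ.map f.toMonoidHom) l := by
  rw [barKerOf, barKerOf, map_topologicalClosure_of_isClosedEmbedding f hf, Subgroup.map_sup,
    Subgroup.map_commutator, Subgroup.map_commutator, normalClosure_powSet_eq Δ l hΔ,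
    normalClosure_powSet_eq _ l hΔ', MonoidHom.map_closure, image_powSet]

/-- **Transport of the `Δ̄_Θ`-preimage** along a closed embedding (as `map_barKerOf`).
[cite: MochizukiEtTh2009, Def 2.1 p.35] -/
theorem map_barThetaOf (f : G →ₜ* G') (hf : IsClosedEmbedding f) (hΔ : Δ.Normal)
    (hΔ' : (Δ.map f.toMonoidHom).Normal) :
    (barThetaOf Δ l).map f.toMonoidHom = barThetaOf (Δ.map f.toMonoidHom) l := by
  rw [barThetaOf, barThetaOf, map_topologicalClosure_of_isClosedEmbedding f hf, Subgroup.map_sup,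
    Subgroup.map_commutator, normalClosure_powSet_eq Δ l hΔ, normalClosure_powSet_eq _ l hΔ',
    MonoidHom.map_closure, image_powSet]

end ClassTwoBar

namespace ThetaSetting

open ClassTwoBar

variable {p : ℕ} [Fact p.Prime] (D : ThetaSetting p) (l : ℕ)

/-- Phase 1a's `barKerHat` IS the generic recipe at `Δ_X ⊆ Π_X` (`rfl`). [cite: MochizukiEtTh2009, Def 2.1 p.35] -/
theorem barKerHat_eq_barKerOf : D.barKerHat l = barKerOf D.DeltaHat l := rfl
/-- Phase 1a's `barThetaHat` IS the generic recipe at `Δ_X ⊆ Π_X` (`rfl`). [cite: MochizukiEtTh2009, Def 2.1 p.35] -/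
theorem barThetaHat_eq_barThetaOf : D.barThetaHat l = barThetaOf D.DeltaHat l := rfl

/-! ### The input package P-C1/P-C2: the profinite `Π_C ⊇ Π_X` with its augmentation -/

/-- **INPUT (W3-L2-02-CENSUS P-C1/P-C2; GAP-LEDGER G-L2t10-2): the profinite étale fundamental group
`Π_C` of `C^log = X^log/{ι}`** over a theta setting — "We shall write `Π_C` … for the … (profinite) étale
fundamental group of `C^log` … subgroups `Δ_C ⊆ Π_C` … [the kernels of the natural surjections to
`G_K`]", "`Gal(X/C) ≅ ℤ/2ℤ`" (p. 36): over a Hausdorff topological group `Π_C` (a PARAMETER `PiC` with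
its instances), a continuous injective homomorphism `Π_X = D.PiHat ↪ Π_C` with NORMAL image of index
`2`, and a continuous augmentation
`Π_C → G_{ℚ_p}` with image `G_K` extending `Π_X → G_K`. DATA quoting print (a parameter bundle,
ruling η′), NOT an assertion that such data exist for a given setting; the §1 structures carry the
tempered `Π^tp_C` only (`MuTwoSetting.GtpC`), without completion or augmentation.
[cite: MochizukiEtTh2009, Def 2.1 p.36] -/
structure PiCData (D : ThetaSetting p) (PiC : Type) [Group PiC] [TopologicalSpace PiC]
    [IsTopologicalGroup PiC] [T2Space PiC] : Type where
  /-- `Π_X ↪ Π_C` (p. 36: `X^log → C^log` is the quotient by `ι`) -/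
  incl : D.PiHat →ₜ* PiC
  /-- `Π_X ↪ Π_C` is injective -/
  incl_injective : Function.Injective incl
  /-- `Π_X ⊴ Π_C` … -/
  range_normal : incl.toMonoidHom.range.Normal
  /-- … with `Gal(X/C) ≅ ℤ/2ℤ` (p. 36) -/
  index_range : incl.toMonoidHom.range.index = 2
  /-- `Π_C → G_{ℚ_p}` (kernel `Δ_C`, p. 36) … -/
  aug : PiC →ₜ* GQp p
  /-- … extending `Π_X → G_K` … -/
  aug_incl : ∀ g, aug (incl g) = D.augHat g
  /-- … with image `G_K` ("`C^log` … over `K`", p. 36) -/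
  range_aug : aug.toMonoidHom.range = D.GK

namespace PiCData

variable {D} {PiC : Type} [Group PiC] [TopologicalSpace PiC] [IsTopologicalGroup PiC] [T2Space PiC]
  (I : D.PiCData PiC)

/-- `Π_X ↪ Π_C` is a CLOSED EMBEDDING (`Π_X` is compact, `Π_C` Hausdorff).
[cite: MochizukiEtTh2009, Def 2.1 p.36] -/
theorem isClosedEmbedding_incl : IsClosedEmbedding I.incl := by
  haveI : CompactSpace D.PiHat := D.isProfiniteCompletion_toHat.compactSpace
  exact (map_continuous I.incl).isClosedEmbedding I.incl_injective

/-- `Π_X ⊆ Π_C` as a subgroup. [cite: MochizukiEtTh2009, Def 2.1 p.36] -/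
abbrev PiX : Subgroup PiC := I.incl.toMonoidHom.range
/-- `Π_X` is closed in `Π_C`. [cite: MochizukiEtTh2009, Def 2.1 p.36] -/
theorem isClosed_PiX : IsClosed (I.PiX : Set PiC) := by
  rw [MonoidHom.coe_range]
  exact I.isClosedEmbedding_incl.isClosed_range

/-- `Π_X` is open in `Π_C` (closed of finite index `2`). [cite: MochizukiEtTh2009, Def 2.1 p.36] -/
theorem isOpen_PiX : IsOpen (I.PiX : Set PiC) := by
  haveI : I.PiX.FiniteIndex := ⟨by rw [I.index_range]; decide⟩
  exact I.PiX.isOpen_of_isClosed_of_finiteIndex I.isClosed_PiX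

/-- `Π_C ↠ G_K` with values in the subgroup `G_K ≤ G_{ℚ_p}`. [cite: MochizukiEtTh2009, Def 2.1 p.36] -/
def augGK : PiC →* D.GK :=
  I.aug.toMonoidHom.codRestrict D.GK fun x => by rw [← I.range_aug]; exact ⟨x, rfl⟩

/-- `augGK` followed by the inclusion is `aug`. [cite: MochizukiEtTh2009, Def 2.1 p.36] -/
@[simp] theorem coe_augGK_apply (x : PiC) : ((I.augGK x : D.GK) : GQp p) = I.aug x := rfl
/-- The kernel of `augGK` is the kernel of `aug` (`Δ_C`). [cite: MochizukiEtTh2009, Def 2.1 p.36] -/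
theorem mem_ker_augGK {x : PiC} : x ∈ I.augGK.ker ↔ I.aug x = 1 := by
  rw [MonoidHom.mem_ker, ← Subtype.coe_inj, coe_augGK_apply, OneMemClass.coe_one]

/-- `Π_X ↠ G_K` is surjective: "`1 → Δ_X → Π_X → G_K → 1`" (p. 35; every element of `G_K` is `aug g`
for some `g ∈ Π^tp_X`, `TemperedCurve.range_aug`). [cite: MochizukiEtTh2009, Def 2.1 p.35] -/
theorem augGK_PiX_surjective : Function.Surjective (I.augGK.restrict I.PiX) := by
  intro γ
  have hγ : (γ : GQp p) ∈ D.aug.toMonoidHom.range := by rw [D.range_aug]; exact γ.2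
  obtain ⟨g, hg⟩ := hγ
  refine ⟨⟨I.incl (D.toHat g), ⟨D.toHat g, rfl⟩⟩, Subtype.ext ?_⟩
  rw [MonoidHom.restrict_apply, coe_augGK_apply, I.aug_incl, D.augHat_comp]
  exact hg

/-! ### `Δ_X ↪ Π_C` and the transported subgroups -/

/-- `Δ_X ⊆ Π_C` (the image of `D.DeltaHat`). [cite: MochizukiEtTh2009, Def 2.1 p.36] -/
def DeltaX : Subgroup PiC := D.DeltaHat.map I.incl.toMonoidHom

/-- **`Δ_X = Π_X ∩ Δ_C`** inside `Π_C` (given (P1) `Ker(Π_X → G_K) = Δ_X` of abc-iut-L2-t7's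
`OncePuncturedData`). [cite: MochizukiEtTh2009, Def 2.1 p.36] -/
theorem deltaX_eq (e : D.OncePuncturedData) : I.DeltaX = I.PiX ⊓ I.augGK.ker := by
  ext x
  rw [Subgroup.mem_inf]
  constructor
  · rintro ⟨d, hd, rfl⟩
    refine ⟨⟨d, rfl⟩, ?_⟩
    rw [I.mem_ker_augGK]
    change I.aug (I.incl d) = 1
    rw [I.aug_incl]
    exact SettingCompletion.deltaHat_le_ker_augHat D.toTemperedCurve hd
  · rintro ⟨⟨g, rfl⟩, hx⟩
    rw [I.mem_ker_augGK] at hx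
    change I.aug (I.incl g) = 1 at hx
    rw [I.aug_incl] at hx
    have hg : g ∈ D.DeltaHat := by rw [← e.ker_augHat]; exact hx
    exact ⟨g, hg, rfl⟩

/-- `Δ_X ⊴ Π_C` (it is `Π_X ∩ Δ_C`). [cite: MochizukiEtTh2009, Def 2.1 p.36] -/
theorem deltaX_normal (e : D.OncePuncturedData) : I.DeltaX.Normal := by
  rw [I.deltaX_eq e]
  haveI := I.range_normal
  exact Subgroup.normal_inf_normal _ _

/-- **`Ker(Δ_X ↠ Δ̄_X)` inside `Π_C`**: the generic recipe at `Δ_X ⊆ Π_C`.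
[cite: MochizukiEtTh2009, Def 2.1 p.35] -/
def barKer (l : ℕ) : Subgroup PiC := barKerOf I.DeltaX l

/-- **The `Δ̄_Θ`-preimage inside `Π_C`**: the generic recipe at `Δ_X ⊆ Π_C`.
[cite: MochizukiEtTh2009, Def 2.1 p.35] -/
def barTheta (l : ℕ) : Subgroup PiC := barThetaOf I.DeltaX l

/-- `I.barKer l` IS the image of phase 1a's `barKerHat` under `Π_X ↪ Π_C`.
[cite: MochizukiEtTh2009, Def 2.1 p.35] -/
theorem barKer_eq_map (e : D.OncePuncturedData) :
    I.barKer l = (D.barKerHat l).map I.incl.toMonoidHom := by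
  rw [barKerHat_eq_barKerOf, map_barKerOf D.DeltaHat l I.incl I.isClosedEmbedding_incl
    D.deltaHat_normal' (I.deltaX_normal e)]
  rfl

/-- `I.barTheta l` IS the image of phase 1a's `barThetaHat` under `Π_X ↪ Π_C`.
[cite: MochizukiEtTh2009, Def 2.1 p.35] -/
theorem barTheta_eq_map (e : D.OncePuncturedData) :
    I.barTheta l = (D.barThetaHat l).map I.incl.toMonoidHom := by
  rw [barThetaHat_eq_barThetaOf, map_barThetaOf D.DeltaHat l I.incl I.isClosedEmbedding_incl
    D.deltaHat_normal' (I.deltaX_normal e)]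
  rfl

/-- `Ker(Δ_X ↠ Δ̄_X) ⊴ Π_C` ("it is normal in `Π_C` (characteristic in `Δ_X`)", `CoverData.barKer_normal`).
[cite: MochizukiEtTh2009, Def 2.1 p.35] -/
theorem barKer_normal (e : D.OncePuncturedData) : (I.barKer l).Normal :=
  barKerOf_normal _ l (I.deltaX_normal e)

/-- The `Δ̄_Θ`-preimage is normal in `Π_C` (`CoverData.barTheta_normal`). [cite: MochizukiEtTh2009, Def 2.1 p.35] -/
theorem barTheta_normal (e : D.OncePuncturedData) : (I.barTheta l).Normal :=
  barThetaOf_normal _ l (I.deltaX_normal e)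

/-- `Ker(Δ_X ↠ Δ̄_X)` is closed in `Π_C` (the REPAIRED field `CoverData.isClosed_barKer`, G-L2d3-5 R1).
[cite: MochizukiEtTh2009, Def 2.1 p.35] -/
theorem isClosed_barKer : IsClosed (I.barKer l : Set PiC) := isClosed_barKerOf _ l

/-- `Ker(Δ_X ↠ Δ̄_X) ≤ Δ̄_Θ`-preimage in `Π_C` (`CoverData.barKer_le_barTheta`).
[cite: MochizukiEtTh2009, Def 2.1 p.35] -/
theorem barKer_le_barTheta (e : D.OncePuncturedData) : I.barKer l ≤ I.barTheta l := by
  rw [I.barKer_eq_map l e, I.barTheta_eq_map l e]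
  exact Subgroup.map_mono (D.barKerHat_le_barThetaHat l)

/-- `Δ̄_Θ`-preimage `≤ Δ_X = Π_X ∩ Δ_C` in `Π_C` (`CoverData.barTheta_le`).
[cite: MochizukiEtTh2009, Def 2.1 p.35] -/
theorem barTheta_le (e : D.OncePuncturedData) : I.barTheta l ≤ I.PiX ⊓ I.augGK.ker := by
  rw [I.barTheta_eq_map l e, ← I.deltaX_eq e]
  exact Subgroup.map_mono (D.barThetaHat_le_deltaHat l)

/-- **`[barTheta : barKer] = l` in `Π_C`** (`CoverData.relIndex_barKer`; transported from phase 1a along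
the injective `Π_X ↪ Π_C`). [cite: MochizukiEtTh2009, Def 2.1 p.35] -/
theorem relIndex_barKer (e : D.OncePuncturedData) (hodd : Odd l) :
    (I.barKer l).relIndex (I.barTheta l) = l := by
  rw [I.barKer_eq_map l e, I.barTheta_eq_map l e,
    Subgroup.relIndex_map_map_of_injective _ _ I.incl_injective]
  exact e.origin.relIndex_barKerHat l hodd

/-- `d ^ l ∈ Ker(Δ_X ↠ Δ̄_X)` for `d ∈ Δ_X = Π_X ∩ Δ_C` (`CoverDataAx.pow_mem_barKer`).
[cite: MochizukiEtTh2009, Def 2.1 p.35] -/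
theorem pow_mem_barKer (e : D.OncePuncturedData) {d : PiC} (hd : d ∈ I.PiX ⊓ I.augGK.ker) :
    d ^ l ∈ I.barKer l := by
  rw [← I.deltaX_eq e] at hd
  obtain ⟨d₀, hd₀, rfl⟩ := hd
  rw [I.barKer_eq_map l e, ← map_pow]
  exact ⟨d₀ ^ l, D.pow_mem_barKerHat l hd₀, rfl⟩

/-- **`Δ̄_Θ` is central in `Δ̄_X`** inside `Π_C` (`CoverData.barTheta_central`).
[cite: MochizukiEtTh2009, Def 2.1 p.35] -/
theorem barTheta_central (e : D.OncePuncturedData) :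
    ∀ t ∈ I.barTheta l, ∀ d ∈ I.PiX ⊓ I.augGK.ker, t * d * t⁻¹ * d⁻¹ ∈ I.barKer l := by
  intro t ht d hd
  rw [← I.deltaX_eq e] at hd
  rw [I.barTheta_eq_map l e] at ht
  obtain ⟨t₀, ht₀, rfl⟩ := ht
  obtain ⟨d₀, hd₀, rfl⟩ := hd
  rw [I.barKer_eq_map l e]
  exact ⟨t₀ * d₀ * t₀⁻¹ * d₀⁻¹, D.barThetaHat_central l t₀ ht₀ d₀ hd₀, by simp only [map_mul, map_inv]⟩

/-- Transport of a quotient isomorphism along an injective homomorphism (bookkeeping for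
`CoverData.ell_rank_two`). [cite: MochizukiEtTh2009, Def 2.1 p.35] -/
theorem nonempty_quotient_mulEquiv_of_map {G H M : Type*} [Group G] [Group H] [Mul M]
    (f : G →* H) (hf : Function.Injective f) (A N : Subgroup G) [(N.subgroupOf A).Normal]
    (A' : Subgroup H) (hA' : A' = A.map f) [((N.map f).subgroupOf A').Normal]
    (h : Nonempty (↥A ⧸ N.subgroupOf A ≃* M)) : Nonempty (↥A' ⧸ (N.map f).subgroupOf A' ≃* M) := by
  subst hA'
  obtain ⟨ε⟩ := h
  let eA : ↥A ≃* ↥(A.map f) := A.equivMapOfInjective f hf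
  have heA : ∀ a : A, ((eA a : ↥(A.map f)) : H) = f a := fun a => rfl
  have he : (N.subgroupOf A).map (eA : ↥A →* ↥(A.map f)) = (N.map f).subgroupOf (A.map f) := by
    ext ⟨x, hx⟩
    rw [Subgroup.mem_map, Subgroup.mem_subgroupOf, Subgroup.mem_map]
    constructor
    · rintro ⟨⟨y, hyA⟩, hyN, hyx⟩
      rw [Subgroup.mem_subgroupOf] at hyN
      have : f y = x := by rw [← heA ⟨y, hyA⟩]; exact congrArg Subtype.val hyx
      exact ⟨y, hyN, this⟩
    · rintro ⟨y, hyN, hyx⟩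
      obtain ⟨y', hy'A, hy'x⟩ := hx
      have hyy' : y' = y := hf (hy'x.trans hyx.symm)
      subst hyy'
      exact ⟨⟨y', hy'A⟩, (Subgroup.mem_subgroupOf).2 hyN, Subtype.ext hy'x⟩
  exact ⟨(QuotientGroup.congr (N.subgroupOf A) ((N.map f).subgroupOf (A.map f)) eA he).symm.trans ε⟩

/-- **"`Δ̄^ell_X` is a free `(ℤ/lℤ)`-module of rank `2`"** inside `Π_C` (`CoverData.ell_rank_two`,
transported from phase 1a). The quotient group structure needs the normality instance, here from
`barTheta_normal`. [cite: MochizukiEtTh2009, Def 2.1 p.35] -/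
theorem ell_rank_two (e : D.OncePuncturedData) [NeZero l] [(I.barTheta l).Normal] :
    Nonempty (↥(I.PiX ⊓ I.augGK.ker) ⧸ (I.barTheta l).subgroupOf (I.PiX ⊓ I.augGK.ker) ≃*
      Multiplicative (ZMod l × ZMod l)) := by
  haveI := D.barThetaHat_normal l
  have h := e.origin.nonempty_quotient_barThetaHat_mulEquiv l (D := D)
  have hA : I.PiX ⊓ I.augGK.ker = D.DeltaHat.map I.incl.toMonoidHom := (I.deltaX_eq e).symm
  have hN : I.barTheta l = (D.barThetaHat l).map I.incl.toMonoidHom := I.barTheta_eq_map l e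
  -- rewrite the normality instance and the statement along `hN`, then transport along `incl`
  revert h
  generalize hΘ : I.barTheta l = Θ at *
  subst hN
  intro h
  exact nonempty_quotient_mulEquiv_of_map I.incl.toMonoidHom I.incl_injective D.DeltaHat
    (D.barThetaHat l) _ hA h

/-! ### The decomposition group of the cusp -/

/-- **`D_x ⊆ Π_X ⊆ Π_C`**, the (closure of the image of the) decomposition group of a cusp `x` of
`X^log` ("`D_x ⊆ Π_X` is the decomposition group associated to `x`", p. 35; `CoverData.Dx`).
[cite: MochizukiEtTh2009, Def 2.1 p.35] -/
def Dx (x : D.Pt) : Subgroup PiC :=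
  (((D.decomp x).map D.toHat.toMonoidHom).topologicalClosure).map I.incl.toMonoidHom

/-- `D_x ≤ Π_X` (`CoverData.Dx_le`). [cite: MochizukiEtTh2009, Def 2.1 p.35] -/
theorem Dx_le (x : D.Pt) : I.Dx x ≤ I.PiX := fun _ ⟨g, _, hg⟩ => ⟨g, hg⟩
/-- **`D_x ↠ G_K`** for a cusp `x` ("`1 → Δ̄_Θ → D̄_x → G_K → 1`": the cusp is `K`-rational, p. 35; from
(P4) `map_aug_decomp` of `OncePuncturedData`; `CoverData.aug_Dx_surjective`).
[cite: MochizukiEtTh2009, Def 2.1 p.35] -/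
theorem augGK_Dx_surjective (e : D.OncePuncturedData) {x : D.Pt} (hx : D.IsCusp x) :
    Function.Surjective (I.augGK.restrict (I.Dx x)) := by
  intro γ
  have hγ : (γ : GQp p) ∈ (D.decomp x).map D.aug.toMonoidHom := by rw [e.map_aug_decomp x hx]; exact γ.2
  obtain ⟨g, hg, hgγ⟩ := hγ
  refine ⟨⟨I.incl (D.toHat g), ⟨D.toHat g, Subgroup.le_topologicalClosure _ ⟨g, hg, rfl⟩, rfl⟩⟩,
    Subtype.ext ?_⟩
  rw [MonoidHom.restrict_apply, coe_augGK_apply, I.aug_incl, D.augHat_comp]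
  exact hgγ

end PiCData

end ThetaSetting

end Literature.AnabelianGeometry.EtaleTheta

end
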